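import Summits.HodgeConjecture.HodgeCM.Automorphic.KernelModelHeisenberg_2

/-! PORT of `HodgeCM/Automorphic/KernelModelHeisenberg.lean` (HodgeCMPerL run 81) — part 3: continuation of `Summits.HodgeConjecture.HodgeCM.Automorphic.KernelModelHeisenberg_2` (split at a top-level declaration boundary by port_pkg.py; scope re-opened below; declarations unchanged). -/

-- port_pkg: scope re-opened for this part (file-level context, then the namespace/section stack open at the cut)
set_option autoImplicit false
noncomputable section
open MeasureTheory Topology
open HodgeCM.PerL34 HodgeCM.PerL34.Annihilation
open scoped RealInnerProductSpace FourierTransform SchwartzMap CompactlySupported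
attribute [-instance] Quotient.instMeasurableSpace
namespace HodgeCM
namespace SchwartzWeil
namespace HeisenbergKernel
attribute [local instance] borelCircle
attribute [local instance] borelT borelSpace_T
attribute [local instance] borelSpace_circle
section Torus
variable (V : Type) [NormedAddCommGroup V] [InnerProductSpace ℝ V] [FiniteDimensional ℝ V] [MeasurableSpace V]
  [BorelSpace V] (L : Submodule ℤ V) [DiscreteTopology L] [IsZLattice ℝ L] (m : ℤ) [NeZero m]
  (Γz : Subgroup Circle) [Finite Γz] (hΓz : ∀ z ∈ Γz, z ^ m = 1)
/-- **EVERY allowed toric period functional is non-zero**: for each `ξ ∈ X` there is a Schwartz bump `Φ` with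
`ϑ_{T,ξ}(Φ)(1) ≠ 0`.  The phase `a ↦ ξ(a, 1)` is continuous, unimodular and `L`-periodic (`dualChar_mk_ofAdd_sub`), so for a
bump `φ` of radius `< δ` around a point `a₀` with `β(a₀, u₀) > 0` it stays within `1/2` of `ξ(a₀, 1)` wherever
`β · Σ_L φ(v − ·) ≠ 0`, whence `|ϑ_{T,ξ}(φ)(1) − ξ(a₀,1) ∫ β Σ_L φ| ≤ ½ ∫ β Σ_L φ` and `|ϑ_{T,ξ}(φ)(1)| ≥ ½ ∫ β Σ_L φ > 0`. -/
theorem ϑc_ne_zero_of_mem (χ : Xw V L m) : ∃ Φ : (W V L m Γz hΓz).SK,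
    (torusCarrier V L m Γz hΓz).ϑc χ Φ (QuotientGroup.mk 1 : Circle ⧸ Γz) ≠ 0 := by
  obtain ⟨t₀, ht₀⟩ := exists_β_ne_zero V L m
  have hD_cont : Continuous fun a : V =>
      dualChar χ.1 (QuotientGroup.mk (Multiplicative.ofAdd a, 1) : (Multiplicative V × Circle) ⧸ ΛT V L m) :=
    (continuous_dualChar χ.1).comp (QuotientGroup.continuous_mk.comp (continuous_ofAdd.prodMk continuous_const))
  obtain ⟨δ, hδ, hδD⟩ := Metric.continuous_iff.mp hD_cont (Multiplicative.toAdd t₀.1) (1 / 2) one_half_pos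
  obtain ⟨φ, Φ, hΦφ, hP, hr⟩ := exists_bump_le V L (Multiplicative.toAdd t₀.1) hδ
  refine ⟨⟨Φ, Set.mem_univ Φ⟩, ?_⟩
  -- the real majorant `g = β · Σ_L φ(v − ·)` (as in `ϑc_ne_zero`): continuous, compactly supported, `≥ 0`, `∫ g > 0`
  let g : Multiplicative V × Circle → ℝ := fun t => β V L m t * ∑' v : L, φ ((v : V) - Multiplicative.toAdd t.1)
  have hPc : ∀ a : V, ∑' v : L, Φ ((v : V) - a) = ((∑' v : L, φ ((v : V) - a) : ℝ) : ℂ) := fun a => by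
    rw [Complex.ofReal_tsum]
    exact tsum_congr fun v => hΦφ _
  have hPcont : Continuous fun a : V => ∑' v : L, φ ((v : V) - a) := by
    refine (Complex.continuous_re.comp (continuous_periodisation V L Φ)).congr fun a => ?_
    simp only [Function.comp_apply, hPc, Complex.ofReal_re]
  have hg_cont : Continuous g :=
    (β V L m).continuous.mul (hPcont.comp (continuous_toAdd.comp continuous_fst))
  have hg_supp : HasCompactSupport g := (β V L m).hasCompactSupport.mul_right
  have hg_nonneg : 0 ≤ g := fun t => mul_nonneg (β_nonneg V L m t) (tsum_nonneg fun v => φ.nonneg)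
  have hg_t₀ : g t₀ ≠ 0 := by
    change β V L m t₀ * ∑' v : L, φ ((v : V) - Multiplicative.toAdd t₀.1) ≠ 0
    rw [hP, mul_one]
    exact ht₀
  have hg_int : Integrable g (torusCarrier V L m Γz hΓz).ν := hg_cont.integrable_of_hasCompactSupport hg_supp
  have hpos : 0 < ∫ t, g t ∂(torusCarrier V L m Γz hΓz).ν :=
    hg_cont.integral_pos_of_hasCompactSupport_nonneg_nonzero hg_supp hg_nonneg hg_t₀
  -- the phase along `T(𝔸)` and its value at `t₀`
  let D : Multiplicative V × Circle → ℂ := fun t =>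
    dualChar χ.1 (QuotientGroup.mk (t.1, 1) : (Multiplicative V × Circle) ⧸ ΛT V L m)
  have hD_cont' : Continuous D :=
    (continuous_dualChar χ.1).comp (QuotientGroup.continuous_mk.comp (continuous_fst.prodMk continuous_const))
  have hD_norm : ∀ t, ‖D t‖ = 1 := fun t => Circle.norm_coe _
  -- the integrand `H = β · D · Σ_L Φ(v − ·)` and the comparison function `D t₀ · g`
  let H : Multiplicative V × Circle → ℂ := fun t =>
    (β V L m t : ℂ) * D t * ∑' v : L, Φ ((v : V) - Multiplicative.toAdd t.1)
  have hH_cont : Continuous H :=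
    ((Complex.continuous_ofReal.comp (β V L m).continuous).mul hD_cont').mul
      ((continuous_periodisation V L Φ).comp (continuous_toAdd.comp continuous_fst))
  have hβC : HasCompactSupport fun t : Multiplicative V × Circle => (β V L m t : ℂ) :=
    (β V L m).hasCompactSupport.comp_left Complex.ofReal_zero
  have hH_supp : HasCompactSupport H := (hβC.mul_right).mul_right
  have hH_int : Integrable H (torusCarrier V L m Γz hΓz).ν := hH_cont.integrable_of_hasCompactSupport hH_supp
  have hG_int : Integrable (fun t => D t₀ * ((g t : ℝ) : ℂ)) (torusCarrier V L m Γz hΓz).ν :=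
    hg_int.ofReal.const_mul (D t₀)
  -- POINTWISE: `‖H t − D t₀ · g t‖ ≤ g t · ½`
  have hpt : ∀ t, ‖H t - D t₀ * ((g t : ℝ) : ℂ)‖ ≤ g t * (1 / 2) := by
    intro t
    have e : H t - D t₀ * ((g t : ℝ) : ℂ) = ((g t : ℝ) : ℂ) * (D t - D t₀) := by
      change (β V L m t : ℂ) * D t * ∑' v : L, Φ ((v : V) - Multiplicative.toAdd t.1) -
          D t₀ * ((β V L m t * ∑' v : L, φ ((v : V) - Multiplicative.toAdd t.1) : ℝ) : ℂ) =
        ((β V L m t * ∑' v : L, φ ((v : V) - Multiplicative.toAdd t.1) : ℝ) : ℂ) * (D t - D t₀)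
      rw [hPc, Complex.ofReal_mul]
      ring
    rw [e, norm_mul, Complex.norm_real, Real.norm_of_nonneg (hg_nonneg t)]
    by_cases hgt : g t = 0
    · rw [hgt, zero_mul, zero_mul]
    refine mul_le_mul_of_nonneg_left ?_ (hg_nonneg t)
    -- `g t ≠ 0` ⇒ some `φ(v − a) ≠ 0` ⇒ `a − v` is `δ`-close to `a₀` ⇒ `D t = ξ(a − v, 1)` is `½`-close to `D t₀`
    have hPt : ∑' v : L, φ ((v : V) - Multiplicative.toAdd t.1) ≠ 0 := fun h0 => hgt (by
      change β V L m t * ∑' v : L, φ ((v : V) - Multiplicative.toAdd t.1) = 0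
      rw [h0, mul_zero])
    obtain ⟨v, hv⟩ : ∃ v : L, φ ((v : V) - Multiplicative.toAdd t.1) ≠ 0 := by
      by_contra hall
      simp only [not_exists, not_not] at hall
      exact hPt (by rw [tsum_congr hall, tsum_zero])
    have hdist : dist (Multiplicative.toAdd t.1 - (v : V)) (Multiplicative.toAdd t₀.1) < δ := by
      rw [← dist_neg_neg, neg_sub]
      exact lt_of_lt_of_le (lt_of_not_ge fun h => hv (φ.zero_of_le_dist h)) hr
    have hclose := hδD (Multiplicative.toAdd t.1 - (v : V)) hdist
    rw [← dualChar_mk_ofAdd_sub V L m χ.1 (Multiplicative.toAdd t.1) v.2, ofAdd_toAdd, ofAdd_toAdd, dist_eq_norm]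
      at hclose
    exact hclose.le
  -- INTEGRATE: `‖ϑ − D t₀ · ∫ g‖ ≤ ½ ∫ g`, `‖D t₀ · ∫ g‖ = ∫ g > 0`
  have hbound : ‖(∫ t, H t ∂(torusCarrier V L m Γz hΓz).ν) - D t₀ * ((∫ t, g t ∂(torusCarrier V L m Γz hΓz).ν : ℝ) : ℂ)‖
      ≤ ∫ t, g t * (1 / 2) ∂(torusCarrier V L m Γz hΓz).ν := by
    rw [← integral_complex_ofReal, ← integral_const_mul, ← integral_sub hH_int hG_int]
    exact norm_integral_le_of_norm_le (hg_int.mul_const _) (Filter.Eventually.of_forall hpt)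
  have hGnorm : ‖D t₀ * ((∫ t, g t ∂(torusCarrier V L m Γz hΓz).ν : ℝ) : ℂ)‖ =
      ∫ t, g t ∂(torusCarrier V L m Γz hΓz).ν := by
    rw [norm_mul, hD_norm, one_mul, Complex.norm_real, Real.norm_of_nonneg hpos.le]
  have hhalf : ∫ t, g t * (1 / 2) ∂(torusCarrier V L m Γz hΓz).ν = (∫ t, g t ∂(torusCarrier V L m Γz hΓz).ν) * (1 / 2) :=
    integral_mul_const _ _
  have key : (∫ t, g t ∂(torusCarrier V L m Γz hΓz).ν) * (1 / 2) ≤ ‖∫ t, H t ∂(torusCarrier V L m Γz hΓz).ν‖ := by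
    have := norm_sub_norm_le (D t₀ * ((∫ t, g t ∂(torusCarrier V L m Γz hΓz).ν : ℝ) : ℂ))
      (∫ t, H t ∂(torusCarrier V L m Γz hΓz).ν)
    rw [hGnorm, ← norm_sub_rev] at this
    linarith
  rw [ϑc_one]
  intro h0
  change (∫ t, H t ∂(torusCarrier V L m Γz hΓz).ν) = 0 at h0
  rw [h0, norm_zero] at key
  linarith

end Torus

/-! ## 4. The compact-quotient input, constructed; AX8 (`AnalyticK`) and `AnalyticU` with no hypothesis -/

section Compact

variable (V : Type) [NormedAddCommGroup V] [InnerProductSpace ℝ V] [FiniteDimensional ℝ V] [MeasurableSpace V]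
  [BorelSpace V] (L : Submodule ℤ V) [DiscreteTopology L] [IsZLattice ℝ L] (m : ℤ) [NeZero m]
  (Γz : Subgroup Circle) [Finite Γz] (hΓz : ∀ z ∈ Γz, z ^ m = 1)

/-- **The compact-quotient input of the model, CONSTRUCTED**: `T(L₀) := Λ = L × μ_m` (countable, closed, `[T]` compact with
its Borel σ-algebra), a fundamental domain of finite Haar measure (pv09-g4 `DiscreteFD.exists_isFundamentalDomain_op_finite`),
`jT(Λ) ≤ arith` (`le_rfl`: `Λ` IS the preimage), `β` sums to one over `Λ`, `T(L₀ ⊗ ℝ) := U(1)` with its Haar probability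
included as the centre (`ιc = inr`), `w = u^{-m}`, `E_w = ⋂_u ker(R(c(u)) − u^{-m})` by `rfl`, the allowed characters
embedded by `Subtype.val` (`emb_spec := rfl`; `emb_surj`: a character of `[T]` with `ξ_∞ = w` is allowed BY DEFINITION of
`X`), finite-adelic factor `{(0, b, 1)} ≅ V` commuting with the centre, and `arith · T(𝔸) · {(0, b, 1)} = Heis V` dense
(it is everything: `(a, b, u) = (a, 0, u 𝐞(⟪a, b⟫)) · (0, b, 1)`). -/
def compactInput : (torusCarrier V L m Γz hΓz).CompactInput where
  Λ := ΛT V L m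
  instΛ₂ := isClosed_ΛT V L m
  exists_fd := by
    obtain ⟨F, -, hF, -, hfin⟩ :=
      DiscreteFD.exists_isFundamentalDomain_op_finite (ΛT V L m) (torusCarrier V L m Γz hΓz).ν
    exact ⟨F, hF, hfin⟩
  jT_Λ := fun _ ht => ht
  β_sum := β_sum V L m
  Tc := Circle
  μ := haarCircle
  ιc := MonoidHom.inr (Multiplicative V) Circle
  ιc_cont := (Continuous.prodMk_right 1 : Continuous fun u : Circle => ((1 : Multiplicative V), u))
  w := weightC m
  w_cont := continuous_weightC m
  w_norm := norm_weightC m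
  Ew_eq := rfl
  emb := fun χ => χ.1
  emb_spec := fun _ _ => rfl
  emb_surj := fun ξ hξ => ⟨⟨ξ, hξ⟩, rfl⟩
  Gf := Multiplicative V
  ιf := modHom V
  comm := fun b u => modHom_mul_ofSchrodinger_one V b u
  dense := fun h => subset_closure ⟨1, one_mem _, (Multiplicative.ofAdd h.a, h.u * 𝐞 ⟪h.a, h.b⟫),
    Multiplicative.ofAdd h.b, by rw [one_mul]; exact eq_ofSchrodinger_mul_modHom V h⟩

/-- **AX8 (PerL v5 Prop. 3.6 Step 2) for the Heisenberg model's torus side, with NO hypothesis**: from the cocompact Haar model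
of the nilmanifold `[U(W)] = Heis V ⧸ arith`, AX1b(a) and the constructed compact-quotient input
(pv15-g2 `KernelTorusCarrier.analyticK_of_compactInput`). -/
theorem analyticK : (torusCarrier V L m Γz hΓz).AnalyticK :=
  (torusCarrier V L m Γz hΓz).analyticK_of_compactInput (QH V L m).isCocompactHaarModel (hatτ_complete V L m Γz hΓz)
    (compactInput V L m Γz hΓz)

/-- **Run 24's analytic package `AnalyticU`** (AX5b, AX12, (U), hence AX8 at the regular-representation level) for the
Heisenberg model's torus side in the Haar model `μ` of `U(W)(𝔸) = Heis V`, with NO hypothesis (pv15-g2 `AnalyticK.toAnalyticU`). -/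
theorem analyticU : (torusCarrier V L m Γz hΓz).toRegTorusCarrier.AnalyticU (QH V L m).μ :=
  KernelTorusCarrier.AnalyticK.toAnalyticU (QH V L m).isCocompactHaarModel (W V L m Γz hΓz).θ_cont
    (W V L m Γz hΓz).θ_omg (analyticK V L m Γz hΓz)

/-- The same input read as pv06-g3's `CompactTorusModelData` (with `unfold` PROVED) and as pv15-g2's `QuotientTorusDatum`
of the model — by name, for consumers of those interfaces. -/
def modelData :=
  (compactInput V L m Γz hΓz).toModelData (QH V L m).isCocompactHaarModel

/-! ### Smoke: every instance hypothesis is met by Mathlib objects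

`V = ℝⁿ` (Euclidean), `L = ℤⁿ` (the `ℤ`-span of the standard orthonormal basis: discrete and a full lattice by Mathlib's
`ZSpan` instances), `Γz = {1}`, any weight `m ≠ 0`. -/
example (n : ℕ) (m : ℤ) [NeZero m] :
    (torusCarrier (EuclideanSpace ℝ (Fin n)) (Submodule.span ℤ (Set.range (PiLp.basisFun 2 ℝ (Fin n)))) m ⊥
      (fun u hu => by rw [Subgroup.mem_bot] at hu; rw [hu, one_zpow])).AnalyticK :=
  analyticK _ _ m ⊥ _

end Compact

end HeisenbergKernel
end SchwartzWeil
end HodgeCM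

end
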